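import Summits.ResolutionOfSingularities.ResolutionOfSingularities.Theorems.WeightedInvariantKeyRungThreeOfDropPointTieOff
import HarnessLib

/-!
# (D-b³-point-STAT) SPLIT BY REGIME: the gap list `keyRungGrHomLE_three_of_tieDescent_pointSplit` = hD + (SIGMA-POINT-ISO) + (TIE-ON) + (CROSSING)
# (door `HypersurfaceCentreConstruction`, stmt-ResolutionOfSingularities-19897, stub `stub_keyRungGrHomLE_three`)

Topic: `Summits/ResolutionOfSingularities/ResolutionOfSingularities/Theorems`.  DEF-FREE.  Helper `--supports stmt-ResolutionOfSingularities-19897`.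

Final bookkeeping of this hand: the non-isolated point starts of (D-b³-point-STAT-REST) (…KeyRungThreeOfDropPointSigma) are the TIE starts
(`ε = 0`, `τ = 1`) and the CROSSING starts (`ε = 1`) (`Iota3.eps_eq_one_or_tie_of_not_isIsolated`); at TIE starts the successors OFF the strict
transform of the equimultiple curve are discharged (…KeyRungThreeOfDropPointTieOff).  Hence the EXACT REMAINING LIST of `stub_keyRungGrHomLE_three`
in gap-list form:

**`keyRungGrHomLE_three_of_tieDescent_pointSplit`** / **`_c11_pointSplit`**: `KeyRungGrHomLE 3 p` ⟸ hD (resp. (c11)≤3) +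
* **(SIGMA-POINT-ISO)** — ISOLATED starts: the pointwise `σ`-comparison at the (isolated, regular, dimension `≤ 3`, exact-order) order-stationary
  `t`-homogeneous successors;
* **(TIE-ON)** — TIE starts (`ε = 0`, `τ = 1`), order-stationary `t`-homogeneous successors ON the strict transform of the equimultiple curve
  (some prime `𝔮 < 𝔫` missing `t⁻¹` lies over `Σ(S, f)`): `ι₃ᵗ(B_𝔫, g/1) < ι₃ᵗ(S, f)`;
* **(CROSSING)** — CROSSING starts (`ε = 1`, centre `J₃ᵗ = jContact`): (D-b³-point-STAT) verbatim.

[OURS · L1 W4.3 · audit glue; AI work, weaker than expert review; nothing here is a statement of the manuscript under review (Hironaka 2017,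
[claim: Hironaka2017, status: under-review]).]
-/

noncomputable section

set_option linter.dupNamespace false -- mandated namespace of this single-conjunct summit

open IsLocalRing Literature.AlgebraicGeometry.Resolution
open Summit.ResolutionOfSingularities.ResolutionOfSingularities.Theorems
open Summit.ResolutionOfSingularities.ResolutionOfSingularities.Theorems.ContactCylinder

namespace Summit.ResolutionOfSingularities.ResolutionOfSingularities.Cruxes.HypersurfaceCentreConstruction.LocalEngine

namespace Iota3

/-- **A non-isolated POINT position is CROSSING or TIE**: at a regular local ring of Krull dimension `≤ 3` whose top `ι₀`-stratum is the closed
point, `¬ IsIsolatedPosition S f` forces `ε = 1` or (`ε = 0` and `τ = 1`). [OURS · L1 W4.3] -/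
theorem eps_eq_one_or_tie_of_not_isIsolated {S : Type} [CommRing S] [IsRegularLocalRing S] (hdim : ringKrullDim S ≤ 3) {f : S}
    (hf : f ∈ maximalIdeal S) (hE : topStratum iotaOrdEpsTau S f = {𝔮 | maximalIdeal S ≤ 𝔮.asIdeal}) (hniso : ¬ IsIsolatedPosition S f) :
    iotaEps S f = 1 ∨ (iotaEps S f = 0 ∧ iotaTau S f = 1) := by
  rcases iotaEps_eq_zero_or_eq_one S f with h0 | h1
  · right
    refine ⟨h0, ?_⟩
    rcases iotaTau_eq_zero_or_eq_one S f with t0 | t1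
    · exfalso
      have hnt : ¬ IsTiePosition S f := (iotaTau_eq_zero_iff_not_isTiePosition hdim f).mp t0
      have h := topStratum_iotaOrdEpsTau_eq_topStratum_iotaOrdEps hdim hnt
      rw [topStratum_iotaOrdEps_eq_topStratum_iotaOrd_of_iotaEps_eq_zero hf h0, hE] at h
      exact hniso h.symm
    · exact t1
  · exact Or.inl h1

/-- **(D-b³-point-STAT-REST) ⟸ (TIE-ON) + (CROSSING)** (the TIE successors off the strict transform are discharged by
`pointStat_tie_offStrictTransform`). [OURS · L1 W4.3 · audit glue] -/
theorem pointStatRest_of_tieOn_crossing (p : ℕ)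
    (hTIE : ∀ (k₀ : Type) [Field k₀] [CharP k₀ p] [PerfectField k₀]
      (S : Type) [CommRing S] [Algebra k₀ S] [Algebra.EssFiniteType k₀ S] [IsRegularLocalRing S]
      (f : S), ringKrullDim S = 3 → f ≠ 0 → f ∈ (maximalIdeal S) ^ 2 →
      ∀ (P : Ideal S) [P.IsPrime], IsRegularLocalRing (S ⧸ P) → f ∈ P →
        topStratum iotaOrdEpsTau S f = {𝔮 | P ≤ 𝔮.asIdeal} → ¬ ringKrullDim (Localization.AtPrime P) ≤ 1 →
        P = maximalIdeal S → iotaEps S f = 0 → iotaTau S f = 1 →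
        ∀ (n : ℕ) (u : Fin n → S) (w : Fin n → ℕ),
          Ideal.span (Set.range u) = maximalIdeal S → (maximalIdeal S).spanFinrank = n → (∃ i, 0 < w i) →
          Ideal.span {x | ∃ i, 0 < w i ∧ x = u i} = P →
          (∀ m : ℕ, weightedMonomialIdeal u w m = jFlatT S f m) →
          ∀ (𝔫 : Ideal (cobordantAlgebra' u w)) [𝔫.IsPrime], IsTHomogeneous u w 𝔫 → cobordantT' u w ∈ 𝔫 →
            (maximalIdeal S).map (algebraMap S (cobordantAlgebra' u w)) ≤ 𝔫 →
            ¬ extReesAlgebra.vertexIdeal (weightedMonomialIdeal u w) ≤ 𝔫 →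
            ∀ (a : ℕ) (g : cobordantAlgebra' u w), algebraMap S (cobordantAlgebra' u w) f = cobordantT' u w ^ a * g →
              ¬ cobordantT' u w ∣ g →
              algebraMap (cobordantAlgebra' u w) (Localization.AtPrime 𝔫) g ∈ maximalIdeal (Localization.AtPrime 𝔫) ^ 2 →
              ∀ ν : ℕ, f ∈ maximalIdeal S ^ ν → f ∉ maximalIdeal S ^ (ν + 1) →
                algebraMap (cobordantAlgebra' u w) (Localization.AtPrime 𝔫) g ∈ maximalIdeal (Localization.AtPrime 𝔫) ^ ν →
                -- the successor lies ON the strict transform of the equimultiple curve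
                (∃ (𝔮 : Ideal (cobordantAlgebra' u w)) (_ : 𝔮.IsPrime), 𝔮 < 𝔫 ∧ cobordantT' u w ∉ 𝔮 ∧
                  (⟨𝔮.comap (algebraMap S (cobordantAlgebra' u w)), Ideal.IsPrime.comap _⟩ : PrimeSpectrum S) ∈ topStratum iotaOrd S f) →
              iotaFlatT (Localization.AtPrime 𝔫) (algebraMap (cobordantAlgebra' u w) (Localization.AtPrime 𝔫) g) <
                iotaFlatT S f)
    (hCROSS : ∀ (k₀ : Type) [Field k₀] [CharP k₀ p] [PerfectField k₀]
      (S : Type) [CommRing S] [Algebra k₀ S] [Algebra.EssFiniteType k₀ S] [IsRegularLocalRing S]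
      (f : S), ringKrullDim S = 3 → f ≠ 0 → f ∈ (maximalIdeal S) ^ 2 →
      ∀ (P : Ideal S) [P.IsPrime], IsRegularLocalRing (S ⧸ P) → f ∈ P →
        topStratum iotaOrdEpsTau S f = {𝔮 | P ≤ 𝔮.asIdeal} → ¬ ringKrullDim (Localization.AtPrime P) ≤ 1 →
        P = maximalIdeal S → iotaEps S f = 1 →
        ∀ (n : ℕ) (u : Fin n → S) (w : Fin n → ℕ),
          Ideal.span (Set.range u) = maximalIdeal S → (maximalIdeal S).spanFinrank = n → (∃ i, 0 < w i) →
          Ideal.span {x | ∃ i, 0 < w i ∧ x = u i} = P →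
          (∀ m : ℕ, weightedMonomialIdeal u w m = jFlatT S f m) →
          ∀ (𝔫 : Ideal (cobordantAlgebra' u w)) [𝔫.IsPrime], IsTHomogeneous u w 𝔫 → cobordantT' u w ∈ 𝔫 →
            (maximalIdeal S).map (algebraMap S (cobordantAlgebra' u w)) ≤ 𝔫 →
            ¬ extReesAlgebra.vertexIdeal (weightedMonomialIdeal u w) ≤ 𝔫 →
            ∀ (a : ℕ) (g : cobordantAlgebra' u w), algebraMap S (cobordantAlgebra' u w) f = cobordantT' u w ^ a * g →
              ¬ cobordantT' u w ∣ g →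
              algebraMap (cobordantAlgebra' u w) (Localization.AtPrime 𝔫) g ∈ maximalIdeal (Localization.AtPrime 𝔫) ^ 2 →
              ∀ ν : ℕ, f ∈ maximalIdeal S ^ ν → f ∉ maximalIdeal S ^ (ν + 1) →
                algebraMap (cobordantAlgebra' u w) (Localization.AtPrime 𝔫) g ∈ maximalIdeal (Localization.AtPrime 𝔫) ^ ν →
              iotaFlatT (Localization.AtPrime 𝔫) (algebraMap (cobordantAlgebra' u w) (Localization.AtPrime 𝔫) g) <
                iotaFlatT S f)
 :
    ∀ (k₀ : Type) [Field k₀] [CharP k₀ p] [PerfectField k₀]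
      (S : Type) [CommRing S] [Algebra k₀ S] [Algebra.EssFiniteType k₀ S] [IsRegularLocalRing S]
      (f : S), ringKrullDim S = 3 → f ≠ 0 → f ∈ (maximalIdeal S) ^ 2 →
      ∀ (P : Ideal S) [P.IsPrime], IsRegularLocalRing (S ⧸ P) → f ∈ P →
        topStratum iotaOrdEpsTau S f = {𝔮 | P ≤ 𝔮.asIdeal} → ¬ ringKrullDim (Localization.AtPrime P) ≤ 1 →
        P = maximalIdeal S → ¬ IsIsolatedPosition S f →
        ∀ (n : ℕ) (u : Fin n → S) (w : Fin n → ℕ),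
          Ideal.span (Set.range u) = maximalIdeal S → (maximalIdeal S).spanFinrank = n → (∃ i, 0 < w i) →
          Ideal.span {x | ∃ i, 0 < w i ∧ x = u i} = P →
          (∀ m : ℕ, weightedMonomialIdeal u w m = jFlatT S f m) →
          ∀ (𝔫 : Ideal (cobordantAlgebra' u w)) [𝔫.IsPrime], IsTHomogeneous u w 𝔫 → cobordantT' u w ∈ 𝔫 →
            (maximalIdeal S).map (algebraMap S (cobordantAlgebra' u w)) ≤ 𝔫 →
            ¬ extReesAlgebra.vertexIdeal (weightedMonomialIdeal u w) ≤ 𝔫 →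
            ∀ (a : ℕ) (g : cobordantAlgebra' u w), algebraMap S (cobordantAlgebra' u w) f = cobordantT' u w ^ a * g →
              ¬ cobordantT' u w ∣ g →
              algebraMap (cobordantAlgebra' u w) (Localization.AtPrime 𝔫) g ∈ maximalIdeal (Localization.AtPrime 𝔫) ^ 2 →
              ∀ ν : ℕ, f ∈ maximalIdeal S ^ ν → f ∉ maximalIdeal S ^ (ν + 1) →
                algebraMap (cobordantAlgebra' u w) (Localization.AtPrime 𝔫) g ∈ maximalIdeal (Localization.AtPrime 𝔫) ^ ν →
              iotaFlatT (Localization.AtPrime 𝔫) (algebraMap (cobordantAlgebra' u w) (Localization.AtPrime 𝔫) g) <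
                iotaFlatT S f := by
  intro k₀ _ _ _ S _ _ _ _ f hd hf0 hf2 P _ hreg hfP hE hP1 hPm hniso n u w h1 h2 h3 h4 h5 𝔫 _ hhom hT hM hV a g hfg hTg hg2 ν hfν hfν1 hgν
  have hf : f ∈ maximalIdeal S := Ideal.pow_le_self two_ne_zero hf2
  have hE' : topStratum iotaOrdEpsTau S f = {𝔮 | maximalIdeal S ≤ 𝔮.asIdeal} := by rw [hE, hPm]
  rcases eps_eq_one_or_tie_of_not_isIsolated (by rw [hd]) hf hE' hniso with h1ε | ⟨h0, t1⟩
  · exact hCROSS k₀ S f hd hf0 hf2 P hreg hfP hE hP1 hPm h1ε n u w h1 h2 h3 h4 h5 𝔫 hhom hT hM hV a g hfg hTg hg2 ν hfν hfν1 hgν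
  · by_cases hon : ∃ (𝔮 : Ideal (cobordantAlgebra' u w)) (_ : 𝔮.IsPrime), 𝔮 < 𝔫 ∧ cobordantT' u w ∉ 𝔮 ∧
        (⟨𝔮.comap (algebraMap S (cobordantAlgebra' u w)), Ideal.IsPrime.comap _⟩ : PrimeSpectrum S) ∈ topStratum iotaOrd S f
    · exact hTIE k₀ S f hd hf0 hf2 P hreg hfP hE hP1 hPm h0 t1 n u w h1 h2 h3 h4 h5 𝔫 hhom hT hM hV a g hfg hTg hg2 ν hfν hfν1 hgν hon
    · refine pointStat_tie_offStrictTransform p k₀ S f hd hf0 hf2 P hE hPm h0 t1 n u w h1 h2 h5 𝔫 hhom hT hV a g hfg hTg ν hfν hfν1 hgν ?_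
      intro 𝔮 _ hlt hT𝔮 hmem
      exact hon ⟨𝔮, ‹_›, hlt, hT𝔮, hmem⟩

/-- **GAP LIST for `stub_keyRungGrHomLE_three` — hD + (SIGMA-POINT-ISO) + (TIE-ON) + (CROSSING).** [OURS · L1 W4.3 · audit glue] -/
theorem keyRungGrHomLE_three_of_tieDescent_pointSplit (p : ℕ)
    (hD : ∀ (T T' : Type) [CommRing T] [IsRegularLocalRing T] [CommRing T'] [IsRegularLocalRing T'] [Algebra T T']
      [IsLocalHom (algebraMap T T')] [Algebra.FormallySmooth T T'] [Algebra.EssFiniteType T T'] (g : T),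
      ringKrullDim T' ≤ 3 → IsTiePosition T' (algebraMap T T' g) → IsTiePosition T g)
    (hSIGMA : ∀ (k₀ : Type) [Field k₀] [CharP k₀ p] [PerfectField k₀]
      (S : Type) [CommRing S] [Algebra k₀ S] [Algebra.EssFiniteType k₀ S] [IsRegularLocalRing S]
      (f : S), ringKrullDim S = 3 → f ≠ 0 → f ∈ (maximalIdeal S) ^ 2 →
      ∀ (P : Ideal S) [P.IsPrime], IsRegularLocalRing (S ⧸ P) → f ∈ P →
        topStratum iotaOrdEpsTau S f = {𝔮 | P ≤ 𝔮.asIdeal} → ¬ ringKrullDim (Localization.AtPrime P) ≤ 1 →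
        P = maximalIdeal S → IsIsolatedPosition S f →
        ∀ (n : ℕ) (u : Fin n → S) (w : Fin n → ℕ),
          Ideal.span (Set.range u) = maximalIdeal S → (maximalIdeal S).spanFinrank = n → (∃ i, 0 < w i) →
          Ideal.span {x | ∃ i, 0 < w i ∧ x = u i} = P →
          (∀ m : ℕ, weightedMonomialIdeal u w m = jFlatT S f m) →
          ∀ (𝔫 : Ideal (cobordantAlgebra' u w)) [𝔫.IsPrime], IsTHomogeneous u w 𝔫 → cobordantT' u w ∈ 𝔫 →
            (maximalIdeal S).map (algebraMap S (cobordantAlgebra' u w)) ≤ 𝔫 →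
            ¬ extReesAlgebra.vertexIdeal (weightedMonomialIdeal u w) ≤ 𝔫 →
            ∀ (a : ℕ) (g : cobordantAlgebra' u w), algebraMap S (cobordantAlgebra' u w) f = cobordantT' u w ^ a * g →
              ¬ cobordantT' u w ∣ g →
              algebraMap (cobordantAlgebra' u w) (Localization.AtPrime 𝔫) g ∈ maximalIdeal (Localization.AtPrime 𝔫) ^ 2 →
              ∀ ν : ℕ, f ∈ maximalIdeal S ^ ν → f ∉ maximalIdeal S ^ (ν + 1) →
                algebraMap (cobordantAlgebra' u w) (Localization.AtPrime 𝔫) g ∈ maximalIdeal (Localization.AtPrime 𝔫) ^ ν →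
                -- SUPPLIED: the successor is isolated, and the order drops strictly below it
                IsIsolatedPosition (Localization.AtPrime 𝔫) (algebraMap (cobordantAlgebra' u w) (Localization.AtPrime 𝔫) g) →
                (∀ (𝔮 : Ideal (cobordantAlgebra' u w)) [𝔮.IsPrime], 𝔮 < 𝔫 →
                  iotaOrd (Localization.AtPrime 𝔮) (algebraMap (cobordantAlgebra' u w) (Localization.AtPrime 𝔮) g) < ν) →
                -- SUPPLIED (this file): regular, of dimension ≤ 3, of order exactly ν
                IsRegularLocalRing (Localization.AtPrime 𝔫) → ringKrullDim (Localization.AtPrime 𝔫) ≤ 3 →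
                algebraMap (cobordantAlgebra' u w) (Localization.AtPrime 𝔫) g ∉ maximalIdeal (Localization.AtPrime 𝔫) ^ (ν + 1) →
              iotaSigma (Localization.AtPrime 𝔫) (algebraMap (cobordantAlgebra' u w) (Localization.AtPrime 𝔫) g) < iotaSigma S f)
    (hTIE : ∀ (k₀ : Type) [Field k₀] [CharP k₀ p] [PerfectField k₀]
      (S : Type) [CommRing S] [Algebra k₀ S] [Algebra.EssFiniteType k₀ S] [IsRegularLocalRing S]
      (f : S), ringKrullDim S = 3 → f ≠ 0 → f ∈ (maximalIdeal S) ^ 2 →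
      ∀ (P : Ideal S) [P.IsPrime], IsRegularLocalRing (S ⧸ P) → f ∈ P →
        topStratum iotaOrdEpsTau S f = {𝔮 | P ≤ 𝔮.asIdeal} → ¬ ringKrullDim (Localization.AtPrime P) ≤ 1 →
        P = maximalIdeal S → iotaEps S f = 0 → iotaTau S f = 1 →
        ∀ (n : ℕ) (u : Fin n → S) (w : Fin n → ℕ),
          Ideal.span (Set.range u) = maximalIdeal S → (maximalIdeal S).spanFinrank = n → (∃ i, 0 < w i) →
          Ideal.span {x | ∃ i, 0 < w i ∧ x = u i} = P →
          (∀ m : ℕ, weightedMonomialIdeal u w m = jFlatT S f m) →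
          ∀ (𝔫 : Ideal (cobordantAlgebra' u w)) [𝔫.IsPrime], IsTHomogeneous u w 𝔫 → cobordantT' u w ∈ 𝔫 →
            (maximalIdeal S).map (algebraMap S (cobordantAlgebra' u w)) ≤ 𝔫 →
            ¬ extReesAlgebra.vertexIdeal (weightedMonomialIdeal u w) ≤ 𝔫 →
            ∀ (a : ℕ) (g : cobordantAlgebra' u w), algebraMap S (cobordantAlgebra' u w) f = cobordantT' u w ^ a * g →
              ¬ cobordantT' u w ∣ g →
              algebraMap (cobordantAlgebra' u w) (Localization.AtPrime 𝔫) g ∈ maximalIdeal (Localization.AtPrime 𝔫) ^ 2 →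
              ∀ ν : ℕ, f ∈ maximalIdeal S ^ ν → f ∉ maximalIdeal S ^ (ν + 1) →
                algebraMap (cobordantAlgebra' u w) (Localization.AtPrime 𝔫) g ∈ maximalIdeal (Localization.AtPrime 𝔫) ^ ν →
                -- the successor lies ON the strict transform of the equimultiple curve
                (∃ (𝔮 : Ideal (cobordantAlgebra' u w)) (_ : 𝔮.IsPrime), 𝔮 < 𝔫 ∧ cobordantT' u w ∉ 𝔮 ∧
                  (⟨𝔮.comap (algebraMap S (cobordantAlgebra' u w)), Ideal.IsPrime.comap _⟩ : PrimeSpectrum S) ∈ topStratum iotaOrd S f) →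
              iotaFlatT (Localization.AtPrime 𝔫) (algebraMap (cobordantAlgebra' u w) (Localization.AtPrime 𝔫) g) <
                iotaFlatT S f)
    (hCROSS : ∀ (k₀ : Type) [Field k₀] [CharP k₀ p] [PerfectField k₀]
      (S : Type) [CommRing S] [Algebra k₀ S] [Algebra.EssFiniteType k₀ S] [IsRegularLocalRing S]
      (f : S), ringKrullDim S = 3 → f ≠ 0 → f ∈ (maximalIdeal S) ^ 2 →
      ∀ (P : Ideal S) [P.IsPrime], IsRegularLocalRing (S ⧸ P) → f ∈ P →
        topStratum iotaOrdEpsTau S f = {𝔮 | P ≤ 𝔮.asIdeal} → ¬ ringKrullDim (Localization.AtPrime P) ≤ 1 →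
        P = maximalIdeal S → iotaEps S f = 1 →
        ∀ (n : ℕ) (u : Fin n → S) (w : Fin n → ℕ),
          Ideal.span (Set.range u) = maximalIdeal S → (maximalIdeal S).spanFinrank = n → (∃ i, 0 < w i) →
          Ideal.span {x | ∃ i, 0 < w i ∧ x = u i} = P →
          (∀ m : ℕ, weightedMonomialIdeal u w m = jFlatT S f m) →
          ∀ (𝔫 : Ideal (cobordantAlgebra' u w)) [𝔫.IsPrime], IsTHomogeneous u w 𝔫 → cobordantT' u w ∈ 𝔫 →
            (maximalIdeal S).map (algebraMap S (cobordantAlgebra' u w)) ≤ 𝔫 →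
            ¬ extReesAlgebra.vertexIdeal (weightedMonomialIdeal u w) ≤ 𝔫 →
            ∀ (a : ℕ) (g : cobordantAlgebra' u w), algebraMap S (cobordantAlgebra' u w) f = cobordantT' u w ^ a * g →
              ¬ cobordantT' u w ∣ g →
              algebraMap (cobordantAlgebra' u w) (Localization.AtPrime 𝔫) g ∈ maximalIdeal (Localization.AtPrime 𝔫) ^ 2 →
              ∀ ν : ℕ, f ∈ maximalIdeal S ^ ν → f ∉ maximalIdeal S ^ (ν + 1) →
                algebraMap (cobordantAlgebra' u w) (Localization.AtPrime 𝔫) g ∈ maximalIdeal (Localization.AtPrime 𝔫) ^ ν →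
              iotaFlatT (Localization.AtPrime 𝔫) (algebraMap (cobordantAlgebra' u w) (Localization.AtPrime 𝔫) g) <
                iotaFlatT S f)
 : KeyRungGrHomLE 3 p :=
  keyRungGrHomLE_three_of_tieDescent_pointSigma p hD hSIGMA (pointStatRest_of_tieOn_crossing p hTIE hCROSS)

/-- **GAP LIST, (c11)-form — (c11)≤3 + (SIGMA-POINT-ISO) + (TIE-ON) + (CROSSING).** [OURS · L1 W4.3 · audit glue] -/
theorem keyRungGrHomLE_three_of_c11_pointSplit (p : ℕ) (hc11 : IotaJEssSmoothCompatibleLE 3 iotaFlatT jFlatT)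
    (hSIGMA : ∀ (k₀ : Type) [Field k₀] [CharP k₀ p] [PerfectField k₀]
      (S : Type) [CommRing S] [Algebra k₀ S] [Algebra.EssFiniteType k₀ S] [IsRegularLocalRing S]
      (f : S), ringKrullDim S = 3 → f ≠ 0 → f ∈ (maximalIdeal S) ^ 2 →
      ∀ (P : Ideal S) [P.IsPrime], IsRegularLocalRing (S ⧸ P) → f ∈ P →
        topStratum iotaOrdEpsTau S f = {𝔮 | P ≤ 𝔮.asIdeal} → ¬ ringKrullDim (Localization.AtPrime P) ≤ 1 →
        P = maximalIdeal S → IsIsolatedPosition S f →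
        ∀ (n : ℕ) (u : Fin n → S) (w : Fin n → ℕ),
          Ideal.span (Set.range u) = maximalIdeal S → (maximalIdeal S).spanFinrank = n → (∃ i, 0 < w i) →
          Ideal.span {x | ∃ i, 0 < w i ∧ x = u i} = P →
          (∀ m : ℕ, weightedMonomialIdeal u w m = jFlatT S f m) →
          ∀ (𝔫 : Ideal (cobordantAlgebra' u w)) [𝔫.IsPrime], IsTHomogeneous u w 𝔫 → cobordantT' u w ∈ 𝔫 →
            (maximalIdeal S).map (algebraMap S (cobordantAlgebra' u w)) ≤ 𝔫 →
            ¬ extReesAlgebra.vertexIdeal (weightedMonomialIdeal u w) ≤ 𝔫 →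
            ∀ (a : ℕ) (g : cobordantAlgebra' u w), algebraMap S (cobordantAlgebra' u w) f = cobordantT' u w ^ a * g →
              ¬ cobordantT' u w ∣ g →
              algebraMap (cobordantAlgebra' u w) (Localization.AtPrime 𝔫) g ∈ maximalIdeal (Localization.AtPrime 𝔫) ^ 2 →
              ∀ ν : ℕ, f ∈ maximalIdeal S ^ ν → f ∉ maximalIdeal S ^ (ν + 1) →
                algebraMap (cobordantAlgebra' u w) (Localization.AtPrime 𝔫) g ∈ maximalIdeal (Localization.AtPrime 𝔫) ^ ν →
                -- SUPPLIED: the successor is isolated, and the order drops strictly below it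
                IsIsolatedPosition (Localization.AtPrime 𝔫) (algebraMap (cobordantAlgebra' u w) (Localization.AtPrime 𝔫) g) →
                (∀ (𝔮 : Ideal (cobordantAlgebra' u w)) [𝔮.IsPrime], 𝔮 < 𝔫 →
                  iotaOrd (Localization.AtPrime 𝔮) (algebraMap (cobordantAlgebra' u w) (Localization.AtPrime 𝔮) g) < ν) →
                -- SUPPLIED (this file): regular, of dimension ≤ 3, of order exactly ν
                IsRegularLocalRing (Localization.AtPrime 𝔫) → ringKrullDim (Localization.AtPrime 𝔫) ≤ 3 →
                algebraMap (cobordantAlgebra' u w) (Localization.AtPrime 𝔫) g ∉ maximalIdeal (Localization.AtPrime 𝔫) ^ (ν + 1) →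
              iotaSigma (Localization.AtPrime 𝔫) (algebraMap (cobordantAlgebra' u w) (Localization.AtPrime 𝔫) g) < iotaSigma S f)
    (hTIE : ∀ (k₀ : Type) [Field k₀] [CharP k₀ p] [PerfectField k₀]
      (S : Type) [CommRing S] [Algebra k₀ S] [Algebra.EssFiniteType k₀ S] [IsRegularLocalRing S]
      (f : S), ringKrullDim S = 3 → f ≠ 0 → f ∈ (maximalIdeal S) ^ 2 →
      ∀ (P : Ideal S) [P.IsPrime], IsRegularLocalRing (S ⧸ P) → f ∈ P →
        topStratum iotaOrdEpsTau S f = {𝔮 | P ≤ 𝔮.asIdeal} → ¬ ringKrullDim (Localization.AtPrime P) ≤ 1 →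
        P = maximalIdeal S → iotaEps S f = 0 → iotaTau S f = 1 →
        ∀ (n : ℕ) (u : Fin n → S) (w : Fin n → ℕ),
          Ideal.span (Set.range u) = maximalIdeal S → (maximalIdeal S).spanFinrank = n → (∃ i, 0 < w i) →
          Ideal.span {x | ∃ i, 0 < w i ∧ x = u i} = P →
          (∀ m : ℕ, weightedMonomialIdeal u w m = jFlatT S f m) →
          ∀ (𝔫 : Ideal (cobordantAlgebra' u w)) [𝔫.IsPrime], IsTHomogeneous u w 𝔫 → cobordantT' u w ∈ 𝔫 →
            (maximalIdeal S).map (algebraMap S (cobordantAlgebra' u w)) ≤ 𝔫 →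
            ¬ extReesAlgebra.vertexIdeal (weightedMonomialIdeal u w) ≤ 𝔫 →
            ∀ (a : ℕ) (g : cobordantAlgebra' u w), algebraMap S (cobordantAlgebra' u w) f = cobordantT' u w ^ a * g →
              ¬ cobordantT' u w ∣ g →
              algebraMap (cobordantAlgebra' u w) (Localization.AtPrime 𝔫) g ∈ maximalIdeal (Localization.AtPrime 𝔫) ^ 2 →
              ∀ ν : ℕ, f ∈ maximalIdeal S ^ ν → f ∉ maximalIdeal S ^ (ν + 1) →
                algebraMap (cobordantAlgebra' u w) (Localization.AtPrime 𝔫) g ∈ maximalIdeal (Localization.AtPrime 𝔫) ^ ν →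
                -- the successor lies ON the strict transform of the equimultiple curve
                (∃ (𝔮 : Ideal (cobordantAlgebra' u w)) (_ : 𝔮.IsPrime), 𝔮 < 𝔫 ∧ cobordantT' u w ∉ 𝔮 ∧
                  (⟨𝔮.comap (algebraMap S (cobordantAlgebra' u w)), Ideal.IsPrime.comap _⟩ : PrimeSpectrum S) ∈ topStratum iotaOrd S f) →
              iotaFlatT (Localization.AtPrime 𝔫) (algebraMap (cobordantAlgebra' u w) (Localization.AtPrime 𝔫) g) <
                iotaFlatT S f)
    (hCROSS : ∀ (k₀ : Type) [Field k₀] [CharP k₀ p] [PerfectField k₀]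
      (S : Type) [CommRing S] [Algebra k₀ S] [Algebra.EssFiniteType k₀ S] [IsRegularLocalRing S]
      (f : S), ringKrullDim S = 3 → f ≠ 0 → f ∈ (maximalIdeal S) ^ 2 →
      ∀ (P : Ideal S) [P.IsPrime], IsRegularLocalRing (S ⧸ P) → f ∈ P →
        topStratum iotaOrdEpsTau S f = {𝔮 | P ≤ 𝔮.asIdeal} → ¬ ringKrullDim (Localization.AtPrime P) ≤ 1 →
        P = maximalIdeal S → iotaEps S f = 1 →
        ∀ (n : ℕ) (u : Fin n → S) (w : Fin n → ℕ),
          Ideal.span (Set.range u) = maximalIdeal S → (maximalIdeal S).spanFinrank = n → (∃ i, 0 < w i) →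
          Ideal.span {x | ∃ i, 0 < w i ∧ x = u i} = P →
          (∀ m : ℕ, weightedMonomialIdeal u w m = jFlatT S f m) →
          ∀ (𝔫 : Ideal (cobordantAlgebra' u w)) [𝔫.IsPrime], IsTHomogeneous u w 𝔫 → cobordantT' u w ∈ 𝔫 →
            (maximalIdeal S).map (algebraMap S (cobordantAlgebra' u w)) ≤ 𝔫 →
            ¬ extReesAlgebra.vertexIdeal (weightedMonomialIdeal u w) ≤ 𝔫 →
            ∀ (a : ℕ) (g : cobordantAlgebra' u w), algebraMap S (cobordantAlgebra' u w) f = cobordantT' u w ^ a * g →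
              ¬ cobordantT' u w ∣ g →
              algebraMap (cobordantAlgebra' u w) (Localization.AtPrime 𝔫) g ∈ maximalIdeal (Localization.AtPrime 𝔫) ^ 2 →
              ∀ ν : ℕ, f ∈ maximalIdeal S ^ ν → f ∉ maximalIdeal S ^ (ν + 1) →
                algebraMap (cobordantAlgebra' u w) (Localization.AtPrime 𝔫) g ∈ maximalIdeal (Localization.AtPrime 𝔫) ^ ν →
              iotaFlatT (Localization.AtPrime 𝔫) (algebraMap (cobordantAlgebra' u w) (Localization.AtPrime 𝔫) g) <
                iotaFlatT S f)
 : KeyRungGrHomLE 3 p :=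
  keyRungGrHomLE_three_of_c11_pointSigma p hc11 hSIGMA (pointStatRest_of_tieOn_crossing p hTIE hCROSS)

end Iota3

end Summit.ResolutionOfSingularities.ResolutionOfSingularities.Cruxes.HypersurfaceCentreConstruction.LocalEngine

end
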